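import Summits.AtomisticToContinuum.FouriersLaw.Theses.OddSectorIrreversibility
import Literature.MathematicalPhysics.KineticTheory.LangevinChainGibbs

/-!
# `ConeScaleCorrector` (E1), line `spatial-doob-determinacy-area`: stub S2 `stub_spatialDoob`

Registered stub of crux stmt-AtomisticToContinuum-14069: the orthogonal-increment (spatial Doob martingale)
identity `∫ u² dμ_T = Σ_{k<N} ∫ (E_{k+1} − E_k)² dμ_T` for mean-zero `u ∈ L²(μ_T)`, `E_k = μ_T[u | σ(q_i,p_i : i<k)]`.

The content is pure measure theory: Pythagoras for conditional expectations on a finite measure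
(`integral_sq_eq_integral_condExp_sq_add`), iterated along a monotone family of sub-σ-algebras
(`integral_condExp_sq_eq_sum`), then instantiated on the site filtration of phase space, whose level `0` is `⊥`
and whose level `N` is the full Borel σ-algebra.
-/

noncomputable section

open MeasureTheory ProbabilityTheory Filter Topology Set
open scoped ENNReal NNReal
open Literature.MathematicalPhysics.KineticTheory.HeatConduction

namespace Summit.AtomisticToContinuum.FouriersLaw.Theorems.OddSectorIrreversibility

/-! ### Generic measure theory: Pythagoras for conditional expectations -/

/-- For `g` `m`-strongly measurable in `L²` and `f ∈ L²` of a finite measure, `∫ g · μ[f|m] = ∫ g · f`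
(pull-out property integrated). [folklore] -/
theorem integral_mul_condExp_of_stronglyMeasurable {α : Type*} {m m₀ : MeasurableSpace α}
    {μ : Measure α} (hm : m ≤ m₀) [IsFiniteMeasure μ] {f g : α → ℝ} (hf : MemLp f 2 μ)
    (hg : MemLp g 2 μ) (hgm : StronglyMeasurable[m] g) :
    ∫ x, g x * (μ[f|m]) x ∂μ = ∫ x, g x * f x ∂μ := by
  have hint : Integrable (g * f) μ := hg.integrable_mul hf
  have hf1 : Integrable f μ := hf.integrable one_le_two
  have h2 : μ[g * f|m] =ᵐ[μ] g * μ[f|m] := condExp_mul_of_stronglyMeasurable_left hgm hint hf1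
  calc ∫ x, g x * (μ[f|m]) x ∂μ = ∫ x, (g * μ[f|m]) x ∂μ := rfl
    _ = ∫ x, (μ[g * f|m]) x ∂μ := (integral_congr_ae h2).symm
    _ = ∫ x, (g * f) x ∂μ := integral_condExp hm
    _ = ∫ x, g x * f x ∂μ := rfl

/-- Pythagoras for the conditional expectation: `∫ f² = ∫ (μ[f|m])² + ∫ (f - μ[f|m])²` for `f ∈ L²`
of a finite measure. [folklore] -/
theorem integral_sq_eq_integral_condExp_sq_add {α : Type*} {m m₀ : MeasurableSpace α}
    {μ : Measure α} (hm : m ≤ m₀) [IsFiniteMeasure μ] {f : α → ℝ} (hf : MemLp f 2 μ) :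
    ∫ x, f x ^ 2 ∂μ = ∫ x, (μ[f|m]) x ^ 2 ∂μ + ∫ x, (f x - (μ[f|m]) x) ^ 2 ∂μ := by
  have hE : MemLp (μ[f|m]) 2 μ := hf.condExp one_le_two
  have horth : ∫ x, (μ[f|m]) x * (μ[f|m]) x ∂μ = ∫ x, (μ[f|m]) x * f x ∂μ :=
    integral_mul_condExp_of_stronglyMeasurable hm hf hE stronglyMeasurable_condExp
  have h1 : Integrable (fun x => f x ^ 2) μ := hf.integrable_sq
  have h2 : Integrable (fun x => (μ[f|m]) x ^ 2) μ := hE.integrable_sq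
  have h3 : Integrable (fun x => (μ[f|m]) x * f x) μ := hE.integrable_mul hf
  have hexp : (fun x => (f x - (μ[f|m]) x) ^ 2) =
      fun x => f x ^ 2 - 2 * ((μ[f|m]) x * f x) + (μ[f|m]) x ^ 2 := by
    funext x; ring
  have hs : Integrable (fun x => f x ^ 2 - 2 * ((μ[f|m]) x * f x)) μ := h1.sub (h3.const_mul 2)
  rw [hexp, integral_add hs h2, integral_sub h1 (h3.const_mul 2), integral_const_mul]
  have h4 : ∫ x, (μ[f|m]) x ^ 2 ∂μ = ∫ x, (μ[f|m]) x * f x ∂μ := by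
    rw [← horth]; congr 1; funext x; ring
  linarith

/-- Orthogonal increments along a monotone family of sub-σ-algebras (Doob martingale energy identity):
`∫ (E_n)² = ∫ (E_0)² + Σ_{k<n} ∫ (E_{k+1} - E_k)²` with `E_k = μ[u | ℱ k]`, for `u ∈ L²` of a finite
measure. [folklore] -/
theorem integral_condExp_sq_eq_sum {α : Type*} {m₀ : MeasurableSpace α} {μ : Measure α}
    [IsFiniteMeasure μ] (ℱ : ℕ → MeasurableSpace α) (hle : ∀ k, ℱ k ≤ m₀)
    (hmono : ∀ k, ℱ k ≤ ℱ (k + 1)) {u : α → ℝ} (hu : MemLp u 2 μ) (n : ℕ) :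
    ∫ x, (μ[u|ℱ n]) x ^ 2 ∂μ =
      ∫ x, (μ[u|ℱ 0]) x ^ 2 ∂μ +
        ∑ k ∈ Finset.range n, ∫ x, ((μ[u|ℱ (k + 1)]) x - (μ[u|ℱ k]) x) ^ 2 ∂μ := by
  induction n with
  | zero => simp
  | succ n ih =>
    rw [Finset.sum_range_succ, ← add_assoc, ← ih]
    have hE : MemLp (μ[u|ℱ (n + 1)]) 2 μ := hu.condExp one_le_two
    have htower : μ[μ[u|ℱ (n + 1)]|ℱ n] =ᵐ[μ] μ[u|ℱ n] :=
      condExp_condExp_of_le (hmono n) (hle (n + 1))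
    rw [integral_sq_eq_integral_condExp_sq_add (hle n) hE]
    congr 1
    · exact integral_congr_ae (htower.mono fun x hx => by simp [hx])
    · exact integral_congr_ae (htower.mono fun x hx => by simp [hx])

/-! ### The site filtration of phase space -/

/-- The σ-algebra generated by the sites `i < k` is a sub-σ-algebra of the Borel σ-algebra of phase space.
[folklore] -/
theorem leftSites_le (N k : ℕ) :
    (⨆ (i : Fin N) (_ : i.val < k),
      MeasurableSpace.comap (fun x : PhaseSpace N => (x.1 i, x.2 i)) inferInstance) ≤
      (inferInstance : MeasurableSpace (PhaseSpace N)) :=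
  iSup₂_le fun i _ =>
    (((measurable_pi_apply i).comp measurable_fst).prodMk
      ((measurable_pi_apply i).comp measurable_snd)).comap_le

/-- The site σ-algebras increase with the number of sites. [folklore] -/
theorem leftSites_mono (N : ℕ) {j k : ℕ} (hjk : j ≤ k) :
    (⨆ (i : Fin N) (_ : i.val < j),
      MeasurableSpace.comap (fun x : PhaseSpace N => (x.1 i, x.2 i)) inferInstance) ≤
      ⨆ (i : Fin N) (_ : i.val < k),
        MeasurableSpace.comap (fun x : PhaseSpace N => (x.1 i, x.2 i)) inferInstance :=
  iSup₂_le fun i hi => le_iSup₂_of_le i (lt_of_lt_of_le hi hjk) le_rfl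

/-- With no sites the site σ-algebra is trivial. [folklore] -/
theorem leftSites_zero (N : ℕ) :
    (⨆ (i : Fin N) (_ : i.val < 0),
      MeasurableSpace.comap (fun x : PhaseSpace N => (x.1 i, x.2 i)) inferInstance) = ⊥ := by
  simp

/-- All `N` sites generate the full Borel σ-algebra of phase space. [folklore] -/
theorem le_leftSites_self (N : ℕ) :
    (inferInstance : MeasurableSpace (PhaseSpace N)) ≤
      ⨆ (i : Fin N) (_ : i.val < N),
        MeasurableSpace.comap (fun x : PhaseSpace N => (x.1 i, x.2 i)) inferInstance := by
  show Prod.instMeasurableSpace ≤ _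
  simp only [Prod.instMeasurableSpace, MeasurableSpace.prod, MeasurableSpace.pi, MeasurableSpace.comap_iSup,
    MeasurableSpace.comap_comp, sup_le_iff, iSup_le_iff]
  constructor
  · intro i
    refine le_iSup₂_of_le i i.isLt ?_
    calc MeasurableSpace.comap ((fun b : Fin N → ℝ => b i) ∘ Prod.fst) (inferInstance : MeasurableSpace ℝ)
        = MeasurableSpace.comap (Prod.fst ∘ fun x : PhaseSpace N => (x.1 i, x.2 i)) inferInstance := rfl
      _ = MeasurableSpace.comap (fun x : PhaseSpace N => (x.1 i, x.2 i))
            (MeasurableSpace.comap Prod.fst inferInstance) := by rw [MeasurableSpace.comap_comp]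
      _ ≤ _ := MeasurableSpace.comap_mono (by exact le_sup_left)
  · intro i
    refine le_iSup₂_of_le i i.isLt ?_
    calc MeasurableSpace.comap ((fun b : Fin N → ℝ => b i) ∘ Prod.snd) (inferInstance : MeasurableSpace ℝ)
        = MeasurableSpace.comap (Prod.snd ∘ fun x : PhaseSpace N => (x.1 i, x.2 i)) inferInstance := rfl
      _ = MeasurableSpace.comap (fun x : PhaseSpace N => (x.1 i, x.2 i))
            (MeasurableSpace.comap Prod.snd inferInstance) := by rw [MeasurableSpace.comap_comp]
      _ ≤ _ := MeasurableSpace.comap_mono (by exact le_sup_right)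

/-- All `N` sites generate exactly the Borel σ-algebra of phase space. [folklore] -/
theorem leftSites_self_eq (N : ℕ) :
    (⨆ (i : Fin N) (_ : i.val < N),
      MeasurableSpace.comap (fun x : PhaseSpace N => (x.1 i, x.2 i)) inferInstance) =
      (inferInstance : MeasurableSpace (PhaseSpace N)) :=
  le_antisymm (leftSites_le N N) (le_leftSites_self N)

/-! ### The generic identity for the weighted Lebesgue measure on phase space -/

/-- Spatial Doob decomposition on phase space: for a finite measure `μ` on `PhaseSpace N`, `u ∈ L²(μ)` with
`∫ u dμ = 0`, `∫ u² dμ = Σ_{k<N} ∫ (E_{k+1} - E_k)² dμ`, `E_k = μ[u | σ(q_i, p_i : i < k)]`. [folklore] -/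
theorem integral_sq_eq_sum_condExp_increments (N : ℕ) (μ : Measure (PhaseSpace N)) [IsFiniteMeasure μ]
    {u : PhaseSpace N → ℝ} (hu : MemLp u 2 μ) (hmean : ∫ x, u x ∂μ = 0) :
    ∫ x, (u x) ^ 2 ∂μ =
      ∑ k : Fin N, ∫ x, (MeasureTheory.condExp
          (⨆ (i : Fin N) (_ : i.val < (k.val + 1)),
            MeasurableSpace.comap (fun x : PhaseSpace N => (x.1 i, x.2 i)) inferInstance) μ u x
        - MeasureTheory.condExp
          (⨆ (i : Fin N) (_ : i.val < k.val),
            MeasurableSpace.comap (fun x : PhaseSpace N => (x.1 i, x.2 i)) inferInstance) μ u x) ^ 2 ∂μ := by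
  have key := integral_condExp_sq_eq_sum (μ := μ)
    (fun k => ⨆ (i : Fin N) (_ : i.val < k),
      MeasurableSpace.comap (fun x : PhaseSpace N => (x.1 i, x.2 i)) inferInstance)
    (leftSites_le N) (fun k => leftSites_mono N (Nat.le_succ k)) hu N
  simp only [leftSites_zero, leftSites_self_eq] at key
  have hEN : μ[u|(inferInstance : MeasurableSpace (PhaseSpace N))] =ᵐ[μ] u :=
    condExp_of_aestronglyMeasurable' le_rfl hu.aestronglyMeasurable (hu.integrable one_le_two)
  have hE0 : ∫ x, (μ[u|⊥]) x ^ 2 ∂μ = 0 := by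
    have h := condExp_bot_ae_eq (μ := μ) u
    rw [hmean, smul_zero] at h
    calc ∫ x, (μ[u|⊥]) x ^ 2 ∂μ = ∫ x, (fun _ => (0 : ℝ)) x ^ 2 ∂μ :=
        integral_congr_ae (h.mono fun x hx => by simp [hx])
      _ = 0 := by simp
  rw [hE0, zero_add, ← Fin.sum_univ_eq_sum_range] at key
  rw [← key]
  exact integral_congr_ae (hEN.mono fun x hx => by simp [hx])

/-- stub S2 (fixed `N`, M; pure measure theory): for `u ∈ L²(μ_T)` with `∫ u dμ_T = 0`, the spatial Doob
martingale `E_k = μ_T[u | G_k]`, `G_k = σ(q_i, p_i : i < k)` written as `⨆_{i<k} comap (x ↦ (q_i,p_i))`, has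
orthogonal increments, `E_0 = 0` (`G_0 = ⊥`, `condExp_bot'`, finite non-zero `μ_T`) and `E_N = u` a.e.
(`G_N` = Borel, `leftSites_self_eq` in this file), hence `∫ u² dμ_T = Σ_{k<N} ∫ (E_{k+1} − E_k)² dμ_T`. -/
theorem stub_spatialDoob :
    ∀ ω₂ lam β γ : ℝ, 0 < ω₂ → 0 < lam → 0 < β → 0 < γ → ∀ T : ℝ, 0 < T →
    ∀ (N : ℕ) (u : PhaseSpace N → ℝ),
    MemLp u 2 (volume.withDensity fun x : PhaseSpace N =>
        ENNReal.ofReal (Real.exp (-((pinnedChain ω₂ lam β γ).hamiltonian N x) / T))) →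
    ∫ x, u x ∂(volume.withDensity fun x : PhaseSpace N =>
        ENNReal.ofReal (Real.exp (-((pinnedChain ω₂ lam β γ).hamiltonian N x) / T))) = 0 →
    ∫ x, (u x) ^ 2 ∂(volume.withDensity fun x : PhaseSpace N =>
        ENNReal.ofReal (Real.exp (-((pinnedChain ω₂ lam β γ).hamiltonian N x) / T))) =
      ∑ k : Fin N, ∫ x, (MeasureTheory.condExp
          (⨆ (i : Fin N) (_ : i.val < (k.val + 1)),
            MeasurableSpace.comap (fun x : PhaseSpace N => (x.1 i, x.2 i)) inferInstance)
          (volume.withDensity fun x : PhaseSpace N =>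
        ENNReal.ofReal (Real.exp (-((pinnedChain ω₂ lam β γ).hamiltonian N x) / T))) u x
        - MeasureTheory.condExp
          (⨆ (i : Fin N) (_ : i.val < k.val),
            MeasurableSpace.comap (fun x : PhaseSpace N => (x.1 i, x.2 i)) inferInstance)
          (volume.withDensity fun x : PhaseSpace N =>
        ENNReal.ofReal (Real.exp (-((pinnedChain ω₂ lam β γ).hamiltonian N x) / T))) u x) ^ 2 ∂(volume.withDensity fun x : PhaseSpace N =>
        ENNReal.ofReal (Real.exp (-((pinnedChain ω₂ lam β γ).hamiltonian N x) / T))) := by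
  intro ω₂ lam β γ hω hl hβ _hγ T hT N u hu hmean
  haveI : IsFiniteMeasure (volume.withDensity fun x : PhaseSpace N =>
      ENNReal.ofReal (Real.exp (-((pinnedChain ω₂ lam β γ).hamiltonian N x) / T))) :=
    isFiniteMeasure_withDensity_ofReal
      (pinnedChain_integrable_gibbsDensity hω hl.le hβ.le γ N hT).hasFiniteIntegral
  exact integral_sq_eq_sum_condExp_increments N _ hu hmean

end Summit.AtomisticToContinuum.FouriersLaw.Theorems.OddSectorIrreversibility
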